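import Mathlib.Analysis.InnerProductSpace.PiL2
import HarnessLib

/-!
# K2R `RealisedQuasiStaticCellLaw`, line `floquet-bloch`, stub `stub_upperSome`: the polarisation-weighted exponent of one
# period against the isotropic value (drift of the slow direction, Lipschitz bound of the slot forms)

Summits-side helper (everything proved; no definitions, no named facts; `--supports stmt-AnomalousDissipation-20446`).
Abstract inner-product bookkeeping of the `stub_upperSome` lane. For unit frame vectors `ζ_m, π_m` (`‖·‖ ≤ 1`), slot
amplitudes `A_m ≥ 0`, in-plane factors `0 ≤ c_m ≤ 1`, slaving weights `σ^o_m ≤ 2 + 2r`, `σ^i_m ≤ 2c_m + 26r`, slow vectors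
`v_m ≠ 0` whose directions stay within `2κ` of the direction of `v_0` (`‖s_m v_m − v_0‖ ≤ κ‖v_0‖`, `s_m > 0`), and the
ISOTROPY identity `Σ_m 2A_m(‖⟪ζ_m,v̂_0⟫‖² + c_m‖⟪π_m,v̂_0⟫‖²) = X`:
`Σ_m A_m (w^o_m σ^o_m + w^i_m σ^i_m) ≤ X + (16κ + 26r)Σ_m A_m`, where `w^o_m = ‖⟪ζ_m,v_m⟫‖²/‖v_m‖²`,
`w^i_m = ‖⟪π_m,v_m⟫‖²/‖v_m‖²`, `w^o_m + w^i_m = 1` (`period_weighted_sum_le`). Energy LOWER-bound half of the K2R bracket; not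
anomalous dissipation.
-/

set_option linter.dupNamespace false -- layout D-0017: `AnomalousDissipation.AnomalousDissipation` repeats by design

noncomputable section

namespace Summit.AnomalousDissipation.AnomalousDissipation.Theorems.SolenoidalFractalHomogenisation.RealisedQuasiStaticCellLaw

open scoped InnerProductSpace BigOperators
open Finset

variable {E : Type*} [NormedAddCommGroup E] [InnerProductSpace ℂ E]

/-- Directions of nearby vectors are nearby: `‖u/‖u‖ − w/‖w‖‖ ≤ 2‖u − w‖/‖w‖` for `u, w ≠ 0` (real scalars coerced
to `ℂ`). -/
theorem norm_normalize_sub_normalize_le {u w : E} (hu : u ≠ 0) (hw : w ≠ 0) :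
    ‖((‖u‖⁻¹ : ℝ) : ℂ) • u - ((‖w‖⁻¹ : ℝ) : ℂ) • w‖ ≤ 2 * ‖u - w‖ / ‖w‖ := by
  have hu0 : 0 < ‖u‖ := norm_pos_iff.2 hu
  have hw0 : 0 < ‖w‖ := norm_pos_iff.2 hw
  have h1 : ‖((‖u‖⁻¹ : ℝ) : ℂ) • u - ((‖w‖⁻¹ : ℝ) : ℂ) • u‖ ≤ ‖u - w‖ / ‖w‖ := by
    rw [← sub_smul, ← Complex.ofReal_sub, norm_smul, Complex.norm_real, Real.norm_eq_abs]
    have e : |‖u‖⁻¹ - ‖w‖⁻¹| * ‖u‖ = |‖w‖ - ‖u‖| / ‖w‖ := by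
      rw [inv_sub_inv hu0.ne' hw0.ne', abs_div, abs_of_pos (mul_pos hu0 hw0)]
      field_simp
    rw [e]
    exact div_le_div_of_nonneg_right ((abs_norm_sub_norm_le w u).trans (by rw [norm_sub_rev])) hw0.le
  have h2 : ‖((‖w‖⁻¹ : ℝ) : ℂ) • u - ((‖w‖⁻¹ : ℝ) : ℂ) • w‖ = ‖u - w‖ / ‖w‖ := by
    rw [← smul_sub, norm_smul, Complex.norm_real, Real.norm_eq_abs, abs_of_pos (inv_pos.2 hw0), div_eq_inv_mul]
  calc ‖((‖u‖⁻¹ : ℝ) : ℂ) • u - ((‖w‖⁻¹ : ℝ) : ℂ) • w‖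
      ≤ ‖((‖u‖⁻¹ : ℝ) : ℂ) • u - ((‖w‖⁻¹ : ℝ) : ℂ) • u‖ + ‖((‖w‖⁻¹ : ℝ) : ℂ) • u - ((‖w‖⁻¹ : ℝ) : ℂ) • w‖ :=
        norm_sub_le_norm_sub_add_norm_sub _ _ _
    _ ≤ ‖u - w‖ / ‖w‖ + ‖u - w‖ / ‖w‖ := add_le_add h1 h2.le
    _ = 2 * ‖u - w‖ / ‖w‖ := by ring

/-- The direction of a positive multiple: `‖(s•v)‖⁻¹ • (s•v) = ‖v‖⁻¹ • v` for `s > 0` (real scalars coerced to `ℂ`). -/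
theorem normalize_smul_pos {s : ℝ} (hs : 0 < s) (v : E) :
    ((‖(s : ℂ) • v‖⁻¹ : ℝ) : ℂ) • ((s : ℂ) • v) = ((‖v‖⁻¹ : ℝ) : ℂ) • v := by
  by_cases hv : v = 0
  · simp [hv]
  · rw [norm_smul, Complex.norm_real, Real.norm_eq_abs, abs_of_pos hs, smul_smul, ← Complex.ofReal_mul, mul_inv]
    congr 1
    push_cast
    have hs' : (s : ℂ) ≠ 0 := by exact_mod_cast hs.ne'
    field_simp

/-- Lipschitz bound of a squared component along a vector of norm `≤ 1` on the unit sphere: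
`|‖⟪e,a⟫‖² − ‖⟪e,b⟫‖²| ≤ 2‖a − b‖` for `‖a‖, ‖b‖ ≤ 1`, `‖e‖ ≤ 1`. -/
theorem abs_norm_inner_sq_sub_le {e a b : E} (he : ‖e‖ ≤ 1) (ha : ‖a‖ ≤ 1) (hb : ‖b‖ ≤ 1) :
    |‖⟪e, a⟫_ℂ‖ ^ 2 - ‖⟪e, b⟫_ℂ‖ ^ 2| ≤ 2 * ‖a - b‖ := by
  have h1 : ‖⟪e, a⟫_ℂ‖ ≤ 1 := (norm_inner_le_norm e a).trans (by nlinarith [norm_nonneg e, norm_nonneg a])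
  have h2 : ‖⟪e, b⟫_ℂ‖ ≤ 1 := (norm_inner_le_norm e b).trans (by nlinarith [norm_nonneg e, norm_nonneg b])
  have h3 : |‖⟪e, a⟫_ℂ‖ - ‖⟪e, b⟫_ℂ‖| ≤ ‖a - b‖ := by
    refine (abs_norm_sub_norm_le _ _).trans ?_
    rw [← inner_sub_right]
    exact (norm_inner_le_norm e (a - b)).trans (by nlinarith [norm_nonneg e, norm_nonneg (a - b)])
  have e1 : ‖⟪e, a⟫_ℂ‖ ^ 2 - ‖⟪e, b⟫_ℂ‖ ^ 2 = (‖⟪e, a⟫_ℂ‖ - ‖⟪e, b⟫_ℂ‖) * (‖⟪e, a⟫_ℂ‖ + ‖⟪e, b⟫_ℂ‖) := by ring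
  rw [e1, abs_mul, abs_of_nonneg (by positivity : 0 ≤ ‖⟪e, a⟫_ℂ‖ + ‖⟪e, b⟫_ℂ‖)]
  nlinarith [abs_nonneg (‖⟪e, a⟫_ℂ‖ - ‖⟪e, b⟫_ℂ‖), norm_nonneg (a - b)]

/-- **The polarisation-weighted exponent of one period against the isotropic value.** See the module docstring. -/
theorem period_weighted_sum_le (k₀ : ℕ) (ζc πc : ℕ → E) (A c σo σi s : ℕ → ℝ) (v : ℕ → E) (X r κ : ℝ)
    (hζ : ∀ m < k₀, ‖ζc m‖ ≤ 1) (hπ : ∀ m < k₀, ‖πc m‖ ≤ 1) (hA : ∀ m < k₀, 0 ≤ A m)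
    (hc : ∀ m < k₀, 0 ≤ c m ∧ c m ≤ 1) (hr : 0 ≤ r)
    (hσo : ∀ m < k₀, σo m ≤ 2 + 2 * r) (hσi : ∀ m < k₀, σi m ≤ 2 * c m + 26 * r)
    (hv : ∀ m < k₀, v m ≠ 0) (hv0 : v 0 ≠ 0) (hs : ∀ m < k₀, 0 < s m)
    (hdrift : ∀ m < k₀, ‖((s m : ℝ) : ℂ) • v m - v 0‖ ≤ κ * ‖v 0‖)
    (hsplit : ∀ m < k₀, ‖⟪ζc m, v m⟫_ℂ‖ ^ 2 + ‖⟪πc m, v m⟫_ℂ‖ ^ 2 = ‖v m‖ ^ 2)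
    (hiso : ∑ m ∈ Finset.range k₀, 2 * A m * (‖⟪ζc m, ((‖v 0‖⁻¹ : ℝ) : ℂ) • v 0⟫_ℂ‖ ^ 2 +
      c m * ‖⟪πc m, ((‖v 0‖⁻¹ : ℝ) : ℂ) • v 0⟫_ℂ‖ ^ 2) = X) :
    ∑ m ∈ Finset.range k₀, A m * (‖⟪ζc m, v m⟫_ℂ‖ ^ 2 / ‖v m‖ ^ 2 * σo m + ‖⟪πc m, v m⟫_ℂ‖ ^ 2 / ‖v m‖ ^ 2 * σi m) ≤
      X + (16 * κ + 26 * r) * ∑ m ∈ Finset.range k₀, A m := by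
  -- unit directions
  set a : ℕ → E := fun m => ((‖v m‖⁻¹ : ℝ) : ℂ) • v m with ha
  have ha1 : ∀ m < k₀, ‖a m‖ = 1 := fun m hm => by
    simp only [ha]; rw [norm_smul, Complex.norm_real, Real.norm_eq_abs,
      abs_of_pos (inv_pos.2 (norm_pos_iff.2 (hv m hm))), inv_mul_cancel₀ (norm_pos_iff.2 (hv m hm)).ne']
  have ha01 : ‖a 0‖ = 1 := by
    simp only [ha]; rw [norm_smul, Complex.norm_real, Real.norm_eq_abs, abs_of_pos (inv_pos.2 (norm_pos_iff.2 hv0)),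
      inv_mul_cancel₀ (norm_pos_iff.2 hv0).ne']
  -- weights in terms of the directions
  have hw : ∀ m < k₀, ∀ e : E, ‖⟪e, v m⟫_ℂ‖ ^ 2 / ‖v m‖ ^ 2 = ‖⟪e, a m⟫_ℂ‖ ^ 2 := by
    intro m hm e
    have hn0 : 0 < ‖v m‖ := norm_pos_iff.2 (hv m hm)
    simp only [ha]
    rw [inner_smul_right, norm_mul, Complex.norm_real, Real.norm_eq_abs, abs_of_pos (inv_pos.2 hn0), mul_pow, inv_pow]
    field_simp
  -- the drift of the directions
  have hda : ∀ m < k₀, ‖a m - a 0‖ ≤ 2 * κ := by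
    intro m hm
    have hsv : ((s m : ℝ) : ℂ) • v m ≠ 0 := smul_ne_zero (by exact_mod_cast (hs m hm).ne') (hv m hm)
    have h := norm_normalize_sub_normalize_le hsv hv0
    rw [normalize_smul_pos (hs m hm)] at h
    have hn0 : 0 < ‖v 0‖ := norm_pos_iff.2 hv0
    calc ‖a m - a 0‖ ≤ 2 * ‖((s m : ℝ) : ℂ) • v m - v 0‖ / ‖v 0‖ := h
      _ ≤ 2 * (κ * ‖v 0‖) / ‖v 0‖ := by gcongr; exact hdrift m hm
      _ = 2 * κ := by field_simp
  have hκ0 : 0 < k₀ → 0 ≤ κ := by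
    intro hk
    have h := hdrift 0 hk
    have hn0 : 0 < ‖v 0‖ := norm_pos_iff.2 hv0
    have : 0 ≤ κ * ‖v 0‖ := (norm_nonneg _).trans h
    nlinarith
  -- termwise bound
  have hterm : ∀ m ∈ Finset.range k₀,
      A m * (‖⟪ζc m, v m⟫_ℂ‖ ^ 2 / ‖v m‖ ^ 2 * σo m + ‖⟪πc m, v m⟫_ℂ‖ ^ 2 / ‖v m‖ ^ 2 * σi m) ≤
        2 * A m * (‖⟪ζc m, a 0⟫_ℂ‖ ^ 2 + c m * ‖⟪πc m, a 0⟫_ℂ‖ ^ 2) + (16 * κ + 26 * r) * A m := by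
    intro m hm'
    have hm : m < k₀ := Finset.mem_range.1 hm'
    rw [hw m hm, hw m hm]
    set wo := ‖⟪ζc m, a m⟫_ℂ‖ ^ 2 with hwo
    set wi := ‖⟪πc m, a m⟫_ℂ‖ ^ 2 with hwi
    have hwo0 : 0 ≤ wo := sq_nonneg _
    have hwi0 : 0 ≤ wi := sq_nonneg _
    have hws : wo + wi = 1 := by
      have h := hsplit m hm
      have e1 := hw m hm (ζc m); have e2 := hw m hm (πc m)
      have hn0 : 0 < ‖v m‖ := norm_pos_iff.2 (hv m hm)
      rw [hwo, hwi, ← e1, ← e2, ← add_div, h, div_self (by positivity)]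
    obtain ⟨hc0, hc1⟩ := hc m hm
    -- `wo σo + wi σi ≤ 2(wo + c wi) + 26 r`
    have h1 : wo * σo m + wi * σi m ≤ 2 * (wo + c m * wi) + 26 * r := by
      have t1 := mul_le_mul_of_nonneg_left (hσo m hm) hwo0
      have t2 := mul_le_mul_of_nonneg_left (hσi m hm) hwi0
      have e : r * wi = r * 1 - r * wo := by rw [← hws]; ring
      have p := mul_nonneg hr hwo0
      linarith
    -- Lipschitz: replace `a m` by `a 0`
    have h2 : wo + c m * wi ≤ ‖⟪ζc m, a 0⟫_ℂ‖ ^ 2 + c m * ‖⟪πc m, a 0⟫_ℂ‖ ^ 2 + 8 * κ := by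
      have l1 := abs_norm_inner_sq_sub_le (hζ m hm) (le_of_eq (ha1 m hm)) (le_of_eq ha01)
      have l2 := abs_norm_inner_sq_sub_le (hπ m hm) (le_of_eq (ha1 m hm)) (le_of_eq ha01)
      have d := hda m hm
      have l1' := (le_abs_self _).trans l1
      have l2' := (le_abs_self _).trans l2
      have l2'' : c m * (‖⟪πc m, a m⟫_ℂ‖ ^ 2 - ‖⟪πc m, a 0⟫_ℂ‖ ^ 2) ≤ c m * (2 * ‖a m - a 0‖) :=
        mul_le_mul_of_nonneg_left l2' hc0
      have l3 : c m * (2 * ‖a m - a 0‖) ≤ 1 * (2 * ‖a m - a 0‖) := mul_le_mul_of_nonneg_right hc1 (by positivity)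
      rw [hwo, hwi]
      linarith
    have hAm := hA m hm
    nlinarith [mul_le_mul_of_nonneg_left h1 hAm, mul_le_mul_of_nonneg_left h2 hAm]
  refine (Finset.sum_le_sum hterm).trans ?_
  rw [Finset.sum_add_distrib, ← Finset.mul_sum]
  simp only [ha] at hiso ⊢
  rw [hiso]

end Summit.AnomalousDissipation.AnomalousDissipation.Theorems.SolenoidalFractalHomogenisation.RealisedQuasiStaticCellLaw

end
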